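import Summits.HubbardSuperconductivity.HubbardSuperconductivity.Theses.ThermalWedge
import Summits.HubbardSuperconductivity.HubbardSuperconductivity.Theorems.TwTipContinuation.Negative.SeededChords
import Literature.MathematicalPhysics.QuantumLattice.DWaveSourceProofs
import Literature.MathematicalPhysics.QuantumLattice.DuhamelTwoPoint
import Literature.MathematicalPhysics.QuantumLattice.HubbardModelParticleHoleProofs

/-!
# Route `ThermalWedge` — support item `TwSectorEnergyLowerBound` (stmt-HubbardSuperconductivity-1701)

The trivial half of the one-point Legendre inequality: for every `L, N, U, μ, β > 0, g` with
`V = szSector N 0 ≠ ⊥`,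
`μ N/L² − p_L(β,μ,U,g) ≤ e(g) = minEnergyOn(H_L(U,g), V)/L²`.

Proof (Griffiths 1965 / Ruelle 1969 §2.5, folklore): for a unit vector `ψ`,
`Z = Σᵢ e^{−βλᵢ} ≥ e^{−βλ_min} ≥ e^{−β re⟨ψ,(H_g − μN̂)ψ⟩}` (single-vector Peierls bound from the
variational principle `groundEnergy_le_rayleigh`); on the sector `⟨ψ,N̂ψ⟩ = N`, so
`re⟨ψ,H_gψ⟩ ≥ μN − (log Z)/β`; take the infimum over unit `ψ ∈ V` (`le_csInf`, the Rayleigh set is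
nonempty since `V ≠ ⊥`) and divide by `L²`.
-/

namespace Summit.HubbardSuperconductivity.HubbardSuperconductivity.Theorems

open Literature.MathematicalPhysics.QuantumLattice Matrix
open Summit.HubbardSuperconductivity.HubbardSuperconductivity.Theses.ThermalWedge
open Summit.HubbardSuperconductivity.TwTipContinuation.Negative
open scoped ComplexOrder

/-- **Single-vector Peierls bound**: for Hermitian `H`, `β ≥ 0` and a unit vector `ψ`,
`e^{−β re⟨ψ,Hψ⟩} ≤ Z(β) = Σᵢ e^{−βλᵢ}` (keep the smallest-eigenvalue term and use the
variational principle). Ruelle (1969) §2.5. [folklore] -/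
theorem exp_neg_rayleigh_le_partitionFn_re {n : Type*} [Fintype n] [DecidableEq n] [Nonempty n]
    {β : ℝ} (hβ : 0 ≤ β) {H : Matrix n n ℂ} (hH : H.IsHermitian) (ψ : n → ℂ)
    (hψ : star ψ ⬝ᵥ ψ = 1) :
    Real.exp (-(β * (star ψ ⬝ᵥ H *ᵥ ψ).re)) ≤ (partitionFn β H).re := by
  rw [hH.partitionFn_eq_ofReal β, Complex.ofReal_re]
  obtain ⟨j, hj⟩ := exists_eq_ciInf_of_finite (f := hH.eigenvalues)
  have hE0 : hH.eigenvalues j ≤ (star ψ ⬝ᵥ H *ᵥ ψ).re := by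
    rw [hj, ← groundEnergy_eq_iInf_eigenvalues_holds hH]
    exact groundEnergy_le_rayleigh_holds hH ψ hψ
  calc Real.exp (-(β * (star ψ ⬝ᵥ H *ᵥ ψ).re))
      ≤ Real.exp (-(β * hH.eigenvalues j)) :=
        Real.exp_le_exp.2 (neg_le_neg (mul_le_mul_of_nonneg_left hE0 hβ))
    _ ≤ ∑ i, Real.exp (-(β * hH.eigenvalues i)) :=
        Finset.single_le_sum (f := fun i => Real.exp (-(β * hH.eigenvalues i)))
          (fun i _ => (Real.exp_pos _).le) (Finset.mem_univ j)

/-- **`TwSectorEnergyLowerBound`** (stmt-HubbardSuperconductivity-1701): the thermodynamic lower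
bound `μN/L² − p_L(β,μ,U,g) ≤ e(g)` on the sector ground-state energy of the seeded Hubbard torus
(trivial half of the one-point Legendre inequality). Griffiths (1965); Ruelle (1969) §2.5. -/
theorem twSectorEnergyLowerBound_proof : TwSectorEnergyLowerBound := by
  intro L _ N U μ β g hβ hV
  set P : Matrix (Finset (Orb (FermionTorus 2 L))) (Finset (Orb (FermionTorus 2 L))) ℂ :=
    (pairField dWaveFormFactor L)ᴴ * pairField dWaveFormFactor L with hPdef
  set Hg := hubbardTorus 2 L 1 U - ((g / (L : ℝ) ^ 2 : ℝ) : ℂ) • P with hHgdef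
  set Kg := hubbardTorusWith 2 L 1 U μ - ((g / (L : ℝ) ^ 2 : ℝ) : ℂ) • P with hKgdef
  have hPh : P.IsHermitian := (pairIntensity_posSemidef L).isHermitian
  have hK : Kg.IsHermitian := by
    refine (isHermitian_hubbardTorusWith L 1 U μ).sub ?_
    unfold Matrix.IsHermitian
    rw [conjTranspose_smul, hPh.eq, Complex.star_def, Complex.conj_ofReal]
  have hKH : Kg = Hg - (μ : ℂ) • totalNumber := by
    simp only [hKgdef, hHgdef, hubbardTorusWith_eq]
    exact sub_right_comm _ _ _
  have hLpos : (0 : ℝ) < (L : ℝ) := by exact_mod_cast NeZero.pos L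
  have hL2 : (0 : ℝ) < (L : ℝ) ^ 2 := by positivity
  have hZpos : 0 < (partitionFn β Kg).re := by
    rw [hK.partitionFn_eq_ofReal β, Complex.ofReal_re]
    exact hK.sum_exp_pos β
  -- the bound for each unit vector of the sector
  have key : ∀ ψ ∈ szSector (Λ := FermionTorus 2 L) N 0, star ψ ⬝ᵥ ψ = 1 →
      μ * N - Real.log (partitionFn β Kg).re / β ≤ (star ψ ⬝ᵥ Hg *ᵥ ψ).re := by
    intro ψ hψV hψ1
    have hN : IsNParticle N ψ := ((mem_szSector_iff N 0 ψ).1 hψV).1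
    have hray : (star ψ ⬝ᵥ Kg *ᵥ ψ).re = (star ψ ⬝ᵥ Hg *ᵥ ψ).re - μ * N := by
      rw [hKH, sub_mulVec, smul_mulVec, totalNumber_mulVec_of_isNParticle hN, smul_smul,
        dotProduct_sub, dotProduct_smul, hψ1]
      simp
    have hpe := exp_neg_rayleigh_le_partitionFn_re hβ.le hK ψ hψ1
    have hlog : -(β * (star ψ ⬝ᵥ Kg *ᵥ ψ).re) ≤ Real.log (partitionFn β Kg).re := by
      rw [← Real.log_exp (-(β * _))]
      exact Real.log_le_log (Real.exp_pos _) hpe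
    rw [hray] at hlog
    have h1 : μ * N - (star ψ ⬝ᵥ Hg *ᵥ ψ).re ≤ Real.log (partitionFn β Kg).re / β := by
      rw [le_div_iff₀ hβ]
      nlinarith
    linarith
  -- infimum over the (nonempty) Rayleigh set of the sector
  have hne : {E : ℝ | ∃ ψ ∈ szSector (Λ := FermionTorus 2 L) N 0,
      star ψ ⬝ᵥ ψ = 1 ∧ E = (star ψ ⬝ᵥ Hg *ᵥ ψ).re}.Nonempty := by
    obtain ⟨ψ₀, hψ₀V, hψ₀⟩ := (Submodule.ne_bot_iff _).1 hV
    obtain ⟨c, -, hc1⟩ := exists_smul_unit hψ₀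
    exact ⟨_, c • ψ₀, Submodule.smul_mem _ c hψ₀V, hc1, rfl⟩
  have hmin : μ * N - Real.log (partitionFn β Kg).re / β ≤ Hg.minEnergyOn (szSector N 0) := by
    apply le_csInf hne
    rintro E ⟨ψ, hψV, hψ1, rfl⟩
    exact key ψ hψV hψ1
  have hdiv := div_le_div_of_nonneg_right hmin hL2.le
  rw [sub_div, div_div] at hdiv
  exact hdiv

end Summit.HubbardSuperconductivity.HubbardSuperconductivity.Theorems
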